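import Summits.Ventures.GridStability.Models.InverterPLLRecast
import Summits.Ventures.GridStability.Lyapunov.AngleRecovery

/-!
# GridStability/Models/InverterPLLRoa — rung G3.d «PLL-swing»: the model-side transport, once and for all

Cell `gridfusion` (LADDER-GRIDFUSION, APEX LINE rung G3.d «PLL-swing» ACCEPTED by the lead,
`plan/PARTITION.md` A21: «-roa lyap-1 (CertificateSoundness applies verbatim); the model-side
transport is model-3's, pattern p471944»); seat gridfusion-model-3 (g3). Companion of
`Models/InverterPLLRecast.lean` (p470346: the recast `GenSwing.polyField`, the chain rule
`GenSwing.hasDerivWithinAt_embed`, the instance of record `GenSwing.duI04` = «PLLSWING-Du-I04») and of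
lyap-1's `Lyapunov/AngleRecovery.lean` (p460639: `angle_recovery`).

THREE COLUMNS. CERTIFIED: nothing in this file — the kernel-checked certificate identities live in
sos-5's Bench file for the A object of record (sos-1: `cert/A/PLLSWING-deg2-A-DuI04.json` cd267481…,
`…deg4-A-DuI04.json` 6ab60336…, `…deg4-A-DuI04-k32-wide.json` dbbe752a…; all with an arc conjunct
`κ ≤ κ_max`, `κ_max ∈ {1, 3/2} < 2`), and their ODE-level consequence for the RECAST system
`ż = F(z)` on `{h = 0}` is lyap-1's `<PFX>_roa` theorem. MODELLED: every theorem here is about the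
printed PLL generalized swing equation `θ̇ = ω`, `ω̇ = I − sin θ − (α cos θ − D) ω`
[cite: DuEtAl2024, Eq. (1)] as typed in `InverterPLL.GenSwing` (p459482) — MODEL-VALIDITY MV-6P
(grid-following converter, SRF-PLL reduced model, current loops algebraic, PLL filter omitted)
+ MV-P (REDEFINED input `I′ = sin θ^s`, A1″). VALIDATED: nothing (the printed «fishlike» basin of
[cite: DuEtAl2024, Fig. 1(a)] is a reservoir-computing estimate — a yardstick for the Bench row, not
a like-for-like object). No sentence of this file says a converter or a grid is stable; «no loss of
lock» below means: the phase mismatch `u = θ − θ^s` OF THE MODEL never reaches `±π`.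

## What is proved (hypothesis = lyap-1's recast conclusion, in its verbatim shape)

`GenSwing.roa_of_recast_roa`: let `G : GenSwing` satisfy the A1 data relations
`(cs, ss) = (cos θ^s, sin θ^s)`, `α`, `D` rational, `I = sin θ^s`; let `F : (Fin 3 → ℝ) → Fin 3 → ℝ`
be ANY field that agrees with `GenSwing.polyField cs ss α D` on the image of the embedding
`y ↦ (sin u, 1 − cos u, ω)` (= `SMIB.embed θ^s`), `M` any set containing that image, `Vz` any
function, `γ` any level and `κ_max < 2`. IF every solution `z` of `ż = F(z)` on `[0, ∞)` (Mathlib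
sense: continuous on `Ici 0`, right derivative `F (z t)`) with `z 0 ∈ M`, `Vz (z 0) ≤ γ` satisfies
`Vz (z t) ≤ γ ∧ z t 1 ≤ κ_max` for all `t ≥ 0` and `z t → 0` — this is EXACTLY the statement
lyap-1's generator emits as `<PFX>_roa` for a Bench certificate with prefix `<PFX>` — THEN for every
solution `(θ, ω)` of `G` (derivatives at all times) whose initial recast state has `Vz ≤ γ` and
`|θ 0 − θ^s| < π`: `Vz ≤ γ` along the recast state and `|θ t − θ^s| < π` for all `t ≥ 0`, and
`(θ t, ω t) → (θ^s, 0)`. `GenSwing.duI04.roa_of_recast_roa`: the same for the instance of record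
«PLLSWING-Du-I04» with the data relations discharged by the kernel facts `duI04.rel_*` (p470346),
conclusion split as `θ → θ^s`, `ω → 0`.

So the hypothesis-free G3.d «-roa» sentence on the converter model is, per certificate, a ≈ 25-line
corollary: `F`-agreement by `fin_cases`/`simp`/`ring` against the Bench `…_f_*_eq` lemmas,
`M`-membership by the Bench `…_h_eq` lemma and `sin² + cos² = 1`, then this theorem (file
`InverterPLLDuI04Roa.lean`, model-3, filed when lyap-1's `<PFX>_roa` lands).
-/

noncomputable section

open Real Set Filter Topology
open Literature.Computation.Certificates Literature.Computation.Certificates.SOS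
open Summit.Ventures.GridStability.Lyapunov

namespace Summit.Ventures.GridStability.Models.InverterPLL.GenSwing

/-- **Model-side transport for the PLL generalized swing equation (rung G3.d), generic in the
certificate.** MODELLED: `InverterPLL.GenSwing` [cite: DuEtAl2024, Eq. (1)] with A1 data relations
(`cs = cos θ^s`, `ss = sin θ^s`, `α`, `D`; REDEFINED `I = sin θ^s`); MV-6P + MV-P. HYPOTHESES on the
certificate side (all discharged per Bench file, none asserted here): `F` agrees with the recast
`polyField cs ss α D` on the image of `SMIB.embed θ^s`; `M ⊇` that image; the recast conclusion
`hroa` in lyap-1's verbatim `<PFX>_roa` shape with arc bound `κ_max < 2`. CONCLUSION: for every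
solution `(θ, ω)` with `Vz(embed(θ 0, ω 0)) ≤ γ` and `|θ 0 − θ^s| < π`: for all `t ≥ 0`,
`Vz(embed(θ t, ω t)) ≤ γ` and `|θ t − θ^s| < π` (the model's phase mismatch never reaches `±π`),
and `(θ t, ω t) → (θ^s, 0)`. Chain rule = `GenSwing.hasDerivWithinAt_embed` (p470346); last step =
lyap-1's `angle_recovery` (IVT + Jordan). No sentence here says a converter is stable. [folklore] -/
theorem roa_of_recast_roa (G : GenSwing) {cs ss α D : ℚ} {θs : ℝ} (hc : (cs : ℝ) = cos θs)
    (hs : (ss : ℝ) = sin θs) (hα : (α : ℝ) = G.α) (hD : (D : ℝ) = G.D) (hI : G.I = sin θs)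
    {F : (Fin 3 → ℝ) → Fin 3 → ℝ}
    (hF : ∀ y : ℝ × ℝ, ∀ k : Fin 3, F (fun i : Fin 3 => SMIB.embed θs y i) k
      = ((polyField cs ss α D).getD k []).eval (SMIB.embed θs y))
    {M : Set (Fin 3 → ℝ)} (hM : ∀ y : ℝ × ℝ, (fun i : Fin 3 => SMIB.embed θs y i) ∈ M)
    {Vz : (Fin 3 → ℝ) → ℝ} {γ κmax : ℝ} (hκ : κmax < 2)
    (hroa : ∀ z : ℝ → Fin 3 → ℝ, ContinuousOn z (Ici 0) →
      (∀ t, 0 ≤ t → HasDerivWithinAt z (F (z t)) (Ici t) t) → z 0 ∈ M → Vz (z 0) ≤ γ →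
      (∀ t, 0 ≤ t → Vz (z t) ≤ γ ∧ z t 1 ≤ κmax) ∧ Tendsto z atTop (𝓝 0))
    {θ ω : ℝ → ℝ} (h : G.IsSolution θ ω)
    (h0V : Vz (fun i : Fin 3 => SMIB.embed θs (θ 0, ω 0) i) ≤ γ) (h0win : |θ 0 - θs| < π) :
    (∀ t, 0 ≤ t → Vz (fun i : Fin 3 => SMIB.embed θs (θ t, ω t) i) ≤ γ ∧ |θ t - θs| < π) ∧
      Tendsto (fun t => (θ t, ω t)) atTop (𝓝 (θs, 0)) := by
  set z : ℝ → Fin 3 → ℝ := fun τ i => SMIB.embed θs (θ τ, ω τ) i with hzdef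
  -- the state curve is continuous (it is differentiable at every time)
  have hθc : Continuous θ := continuous_iff_continuousAt.2 fun t => (h.angle t).continuousAt
  have hωc : Continuous ω := continuous_iff_continuousAt.2 fun t => (h.freq t).continuousAt
  have hzc : ContinuousOn z (Ici 0) := by
    have hc' : Continuous fun y : ℝ × ℝ => fun i : Fin 3 => SMIB.embed θs y i := by
      refine continuous_pi fun i => ?_
      fin_cases i <;> simp [SMIB.embed] <;> fun_prop
    exact (hc'.comp (hθc.prodMk hωc)).continuousOn
  -- exact embedding: the recast curve solves `ż = F(z)` (model-3's chain rule, p470346)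
  have hz : ∀ t, 0 ≤ t → HasDerivWithinAt z (F (z t)) (Ici t) t := by
    intro t _ht
    refine hasDerivWithinAt_pi.2 fun k => ?_
    have hk := G.hasDerivWithinAt_embed hc hs hα hD hI h (s := Ici t) (t := t) self_mem_Ici k
    have hFk : F (z t) k = ((polyField cs ss α D).getD k []).eval (SMIB.embed θs (θ t, ω t)) :=
      hF (θ t, ω t) k
    rw [hFk]
    exact hk
  have h0M : z 0 ∈ M := hM (θ 0, ω 0)
  obtain ⟨hinv, hlim⟩ := hroa z hzc hz h0M h0V
  -- arc bound `1 - cos u ≤ κ_max < 2` and `1 - cos u → 0`, `ω → 0` from the recast conclusion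
  have hbound : ∀ t, 0 ≤ t → 1 - cos (θ t - θs) ≤ κmax := by
    intro t ht
    have hk := (hinv t ht).2
    simp only [hzdef, Fin.val_one, SMIB.embed_one] at hk
    exact hk
  have hκlim : Tendsto (fun t => 1 - cos (θ t - θs)) atTop (𝓝 0) := by
    simpa [hzdef] using tendsto_pi_nhds.1 hlim 1
  have hωlim : Tendsto ω atTop (𝓝 0) := by
    simpa [hzdef] using tendsto_pi_nhds.1 hlim 2
  -- angle recovery (lyap-1, A6): no crossing of `±π`, and `u → 0`
  have huc : ContinuousOn (fun t => θ t - θs) (Ici 0) := (hθc.sub continuous_const).continuousOn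
  obtain ⟨hwin, hu⟩ := angle_recovery hκ huc h0win hbound hκlim
  have hθlim : Tendsto θ atTop (𝓝 θs) := by
    have h' := hu.add_const θs
    simpa using h'
  refine ⟨fun t ht => ⟨(hinv t ht).1, hwin t ht⟩, ?_⟩
  simpa using hθlim.prodMk_nhds hωlim

namespace duI04

/-- **Rung G3.d, instance of record «PLLSWING-Du-I04» (lead A21): model-side transport with the
data relations discharged.** MODELLED: `GenSwing.duI04` = printed `(I, D, α) = (0.4, 0.39, 0.7)`
[cite: DuEtAl2024, §II text to Fig. 1(a)] with `I′ = 63365/158413` (A1″, `t = 115/551`),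
`θ^s = arcsin(63365/158413)`; MV-6P + MV-P. For ANY certificate field `F` agreeing with
`GenSwing.polyField (145188/158413) (63365/158413) (7/10) (39/100)` on the embedding, constraint set
`M` containing the embedding, `Vz`, level `γ`, arc bound `κ_max < 2`, and lyap-1's recast conclusion
`hroa`: every solution `(θ, ω)` of the instance with `Vz(embed(θ 0, ω 0)) ≤ γ`, `|θ 0 − θ^s| < π`
keeps `Vz ≤ γ` and `|θ t − θ^s| < π` for all `t ≥ 0`, and `θ t → θ^s`, `ω t → 0`. The per-certificate
hypothesis-free corollary instantiates `F, M, Vz, γ, κ_max, hroa` with the Bench / lyap-1 decls.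
No sentence here says a converter is stable. [folklore] -/
theorem roa_of_recast_roa {F : (Fin 3 → ℝ) → Fin 3 → ℝ}
    (hF : ∀ y : ℝ × ℝ, ∀ k : Fin 3, F (fun i : Fin 3 => SMIB.embed duI04_θs y i) k
      = ((polyField (145188 / 158413) (63365 / 158413) (7 / 10) (39 / 100)).getD k []).eval
          (SMIB.embed duI04_θs y))
    {M : Set (Fin 3 → ℝ)} (hM : ∀ y : ℝ × ℝ, (fun i : Fin 3 => SMIB.embed duI04_θs y i) ∈ M)
    {Vz : (Fin 3 → ℝ) → ℝ} {γ κmax : ℝ} (hκ : κmax < 2)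
    (hroa : ∀ z : ℝ → Fin 3 → ℝ, ContinuousOn z (Ici 0) →
      (∀ t, 0 ≤ t → HasDerivWithinAt z (F (z t)) (Ici t) t) → z 0 ∈ M → Vz (z 0) ≤ γ →
      (∀ t, 0 ≤ t → Vz (z t) ≤ γ ∧ z t 1 ≤ κmax) ∧ Tendsto z atTop (𝓝 0))
    {θ ω : ℝ → ℝ} (h : duI04.IsSolution θ ω)
    (h0V : Vz (fun i : Fin 3 => SMIB.embed duI04_θs (θ 0, ω 0) i) ≤ γ)
    (h0win : |θ 0 - duI04_θs| < π) :
    (∀ t, 0 ≤ t → Vz (fun i : Fin 3 => SMIB.embed duI04_θs (θ t, ω t) i) ≤ γ ∧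
        |θ t - duI04_θs| < π) ∧
      Tendsto θ atTop (𝓝 duI04_θs) ∧ Tendsto ω atTop (𝓝 0) := by
  obtain ⟨hinv, hlim⟩ :=
    GenSwing.roa_of_recast_roa duI04 rel_c rel_s rel_α rel_D rel_I hF hM hκ hroa h h0V h0win
  refine ⟨hinv, ?_, ?_⟩
  · simpa using hlim.fst_nhds
  · simpa using hlim.snd_nhds

end duI04

end Summit.Ventures.GridStability.Models.InverterPLL.GenSwing

end
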